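import Literature.Analysis.Complex.WeierstrassPreparation
import Literature.NumberTheory.Transcendental.AndreCriterionAnalyticProofs
import Mathlib.Analysis.Complex.TaylorSeries
import Mathlib.Analysis.Complex.RemovableSingularity
import Mathlib.Analysis.Calculus.Deriv.Polynomial
import Mathlib.RingTheory.PowerSeries.Order
import Mathlib.RingTheory.PowerSeries.Trunc
import Mathlib.Algebra.Polynomial.Derivative
import Mathlib.Algebra.Polynomial.Div
import HarnessLib

/-!
# Formal power series roots of analytic equations are analytic

Topic `Literature/Analysis/Complex` (namespace `Literature.Analysis.Complex.FormalRoot`).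
Everything here is PROVED (no definitions, no named facts; `𝓣[·]` is local notation).

Let `b₀, …, b_d` be holomorphic on a disc `|q| < r` and let
`𝒬(Y) = Σₙ 𝓣[bₙ] Yⁿ ∈ ℂ⟦q⟧[Y]` be the polynomial whose coefficients are their Taylor series at
`0`. **If `ŷ ∈ ℂ⟦q⟧` is a simple formal root of `𝒬` (`𝒬(ŷ) = 0`, `𝒬'(ŷ) ≠ 0`), then `ŷ` is
the Taylor series of a holomorphic root**: for every `K₀` there are `K ≥ K₀`, `ε > 0` and `y`
holomorphic on `|q| < ε` with `Σₙ bₙ(q) y(q)ⁿ = 0` and `y⁽ⁿ⁾(0)/n! = [qⁿ] ŷ` for `n < K`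
(`exists_holomorphic_root_of_formal_root`). This is the classical convergence of formal
solutions of analytic equations in the non-degenerate case (the one-variable, polynomial case
of the analytic implicit function theorem for formal solutions; e.g. J. M. Ruiz, *The basic theory
of power series*, Prop. 3.6 / M. Artin, Invent. Math. 5 (1968) in general). Proof (Tougeron's
trick): with `v = ord 𝒬'(ŷ)` and `p` the truncation of `ŷ` at order `M + v` (`M > v`),
substituting `Y = p(q) + q^M W` gives `Σ bₙ (p + q^M W)ⁿ = q^{M+v} Φ(q, W)` with `Φ` holomorphic,
`Φ(0, ·)` affine with slope `[q^v] 𝒬'(ŷ) ≠ 0`; a simple zero of a holomorphic function of two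
variables moves holomorphically (`exists_holomorphic_simple_root`, from the Weierstrass
preparation set-up of `Literature/Analysis/Complex/WeierstrassPreparation.lean`).

Supporting dictionary between germs at `0` and `ℂ⟦q⟧` (the Taylor series
`𝓣[f] = Σ (f⁽ⁿ⁾(0)/n!) qⁿ` of `Literature/NumberTheory/Transcendental/AndreCriterionAnalyticProofs`):
`taylor_eq_zero_iff`, `eventuallyEq_of_taylor_eq` (injectivity on analytic germs),
`hasSum_taylor_of_differentiableOn`, `taylor_polynomial`, `exists_taylor_remainder_on_ball`
(`f = Σ_{k<N} aₖ qᵏ + q^N g` on the whole disc), `exists_eq_pow_mul_of_coeff_eq_zero`, and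
holomorphic division with prescribed Taylor series `exists_eq_mul_of_taylor_eq_mul`.

Written for the analytic proof that Galois conjugates of (noncongruence) modular forms are
modular forms (Calegari–Dimitrov–Tang, *The unbounded denominators conjecture*, Remark 59), where
conjugated formal roots of the minimal polynomial of a modular function over `ℂ(λ)` have to be
summed. [folklore]

## References

* J. M. Ruiz, *The basic theory of power series*, Vieweg 1993, §3 (implicit functions for
  formal and convergent series). [folklore]
* E. M. Chirka, *Complex Analytic Sets*, Kluwer 1989, §1.1 (roots depending holomorphically on
  parameters). [Chirka1989]
-/

noncomputable section

open Complex Filter Topology Set Metric Finset PowerSeries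
open scoped Nat Polynomial

namespace Literature.Analysis.Complex

namespace FormalRoot

open Literature.NumberTheory.Transcendental.AndreCriterion (coeff_taylor constantCoeff_taylor
  taylor_congr taylor_add taylor_sum taylor_const_mul taylor_mul taylor_one taylor_pow)
open Literature.Analysis.Complex.SCV

/-- The Taylor series of `f : ℂ → ℂ` at `0`, as a formal power series (local notation, as in
`AndreCriterionAnalyticProofs`). -/
local notation3 "𝓣[" f "]" =>
  (PowerSeries.mk fun n => ((Nat.factorial n : ℂ)⁻¹ * iteratedDeriv n f 0) : PowerSeries ℂ)

/-! ### 1. The Taylor series at `0`: vanishing, injectivity, summation -/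

/-- An analytic germ has zero Taylor series iff it vanishes near `0`. [folklore] -/
theorem taylor_eq_zero_iff {f : ℂ → ℂ} (hf : AnalyticAt ℂ f 0) :
    𝓣[f] = 0 ↔ f =ᶠ[𝓝 0] 0 := by
  constructor
  · intro h
    have hall : ∀ n : ℕ, iteratedDeriv n f 0 = 0 := fun n ↦ by
      have := congrArg (coeff n) h
      rw [coeff_taylor, map_zero, mul_eq_zero] at this
      exact this.resolve_left (inv_ne_zero (by exact_mod_cast (Nat.factorial_ne_zero n)))
    have htop : analyticOrderAt f 0 = ⊤ := by
      refine ENat.eq_top_iff_forall_ge.mpr fun n ↦ ?_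
      exact (natCast_le_analyticOrderAt_iff_iteratedDeriv_eq_zero hf).2 fun i _ ↦ hall i
    exact analyticOrderAt_eq_top.mp htop
  · intro h
    rw [taylor_congr h]
    ext n
    rw [coeff_taylor, map_zero]
    simp

/-- Subtraction of Taylor series. [folklore] -/
theorem taylor_sub {f g : ℂ → ℂ} (hf : AnalyticAt ℂ f 0) (hg : AnalyticAt ℂ g 0) :
    𝓣[f - g] = 𝓣[f] - 𝓣[g] := by
  ext n
  rw [map_sub, coeff_taylor, coeff_taylor, coeff_taylor,
    iteratedDeriv_sub hf.contDiffAt hg.contDiffAt, mul_sub]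

/-- **Injectivity of the Taylor series on analytic germs.** [folklore] -/
theorem eventuallyEq_of_taylor_eq {f g : ℂ → ℂ} (hf : AnalyticAt ℂ f 0) (hg : AnalyticAt ℂ g 0)
    (h : 𝓣[f] = 𝓣[g]) : f =ᶠ[𝓝 0] g := by
  have h0 : 𝓣[f - g] = 0 := by rw [taylor_sub hf hg, h, sub_self]
  have := (taylor_eq_zero_iff (hf.sub hg)).1 h0
  filter_upwards [this] with z hz
  simpa [sub_eq_zero] using hz

/-- A function holomorphic on the disc `|z| < r` is the sum of its Taylor series there.
[folklore] -/
theorem hasSum_taylor_of_differentiableOn {f : ℂ → ℂ} {r : ℝ}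
    (hf : DifferentiableOn ℂ f (ball 0 r)) {z : ℂ} (hz : z ∈ ball 0 r) :
    HasSum (fun n ↦ coeff n 𝓣[f] * z ^ n) (f z) := by
  have h := Complex.hasSum_taylorSeries_on_ball hf hz
  have h' : (fun n ↦ coeff n 𝓣[f] * z ^ n) =
      fun n : ℕ ↦ (n ! : ℂ)⁻¹ • (z - 0) ^ n • iteratedDeriv n f 0 := by
    funext n
    rw [coeff_taylor, sub_zero, smul_eq_mul, smul_eq_mul]
    ring
  rw [h']
  exact h

/-- Differentiability on a ball around `0` gives analyticity at `0`. [folklore] -/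
theorem analyticAt_of_differentiableOn_ball {f : ℂ → ℂ} {r : ℝ} (hr : 0 < r)
    (hf : DifferentiableOn ℂ f (ball 0 r)) : AnalyticAt ℂ f 0 :=
  (hf.analyticOnNhd isOpen_ball) 0 (mem_ball_self hr)

/-! ### 2. Polynomials -/

/-- Iterated derivatives of a polynomial function. [folklore] -/
theorem iteratedDeriv_polynomial_eval (P : ℂ[X]) (n : ℕ) :
    iteratedDeriv n (fun z ↦ P.eval z) = fun z ↦ (Polynomial.derivative^[n] P).eval z := by
  induction n with
  | zero => simp
  | succ n ih =>
    rw [iteratedDeriv_succ, ih, Function.iterate_succ_apply']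
    funext z
    exact Polynomial.deriv _

/-- **The Taylor series of a polynomial function is the polynomial.** [folklore] -/
theorem taylor_polynomial (P : ℂ[X]) : 𝓣[fun z ↦ P.eval z] = (P : PowerSeries ℂ) := by
  ext n
  rw [coeff_taylor, iteratedDeriv_polynomial_eval, Polynomial.coeff_coe]
  dsimp only
  rw [← Polynomial.coeff_zero_eq_eval_zero, Polynomial.coeff_iterate_derivative, zero_add,
    Nat.descFactorial_self, nsmul_eq_mul]
  have hn : ((n ! : ℕ) : ℂ) ≠ 0 := by exact_mod_cast Nat.factorial_ne_zero n
  field_simp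

/-- The Taylor series of `z ↦ z ^ N`. [folklore] -/
theorem taylor_pow_id (N : ℕ) : 𝓣[fun z : ℂ ↦ z ^ N] = PowerSeries.X ^ N := by
  have h := taylor_polynomial ((Polynomial.X : ℂ[X]) ^ N)
  simp only [Polynomial.eval_pow, Polynomial.eval_X, Polynomial.coe_pow, Polynomial.coe_X] at h
  exact h

/-! ### 3. Taylor remainders on a disc and formal divisibility -/

/-- **Taylor's formula with holomorphic remainder on the whole disc**: for `f` holomorphic on
`|z| < r` and every `N`, `f(z) = Σ_{k<N} ([qᵏ]𝓣[f]) zᵏ + z^N g(z)` on the disc with `g`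
holomorphic on the same disc and `𝓣[f] = Σ_{k<N} [qᵏ]𝓣[f] Xᵏ + X^N 𝓣[g]`. [folklore] -/
theorem exists_taylor_remainder_on_ball {f : ℂ → ℂ} {r : ℝ} (hr : 0 < r)
    (hf : DifferentiableOn ℂ f (ball 0 r)) (N : ℕ) :
    ∃ g : ℂ → ℂ, DifferentiableOn ℂ g (ball 0 r) ∧
      (∀ z ∈ ball 0 r, f z = (∑ k ∈ range N, coeff k 𝓣[f] * z ^ k) + z ^ N * g z) ∧
      𝓣[f] = (∑ k ∈ range N, PowerSeries.C (coeff k 𝓣[f]) * PowerSeries.X ^ k) +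
        PowerSeries.X ^ N * 𝓣[g] := by
  have hball : ball (0 : ℂ) r ∈ 𝓝 (0 : ℂ) := ball_mem_nhds 0 hr
  -- First produce SOME expansion `f = Σ_{k<N} a_k z^k + z^N g` with `g` holomorphic.
  have key : ∀ N : ℕ, ∃ (a : ℕ → ℂ) (g : ℂ → ℂ), DifferentiableOn ℂ g (ball 0 r) ∧
      ∀ z ∈ ball 0 r, f z = (∑ k ∈ range N, a k * z ^ k) + z ^ N * g z := by
    intro N
    induction N with
    | zero => exact ⟨fun _ ↦ 0, f, hf, fun z _ ↦ by simp⟩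
    | succ N ih =>
      obtain ⟨a, g, hg, hfg⟩ := ih
      refine ⟨fun k ↦ if k = N then g 0 else a k, dslope g 0,
        (Complex.differentiableOn_dslope hball).2 hg, fun z hz ↦ ?_⟩
      have hds : z * dslope g 0 z = g z - g 0 := by
        have := sub_smul_dslope g 0 z
        rwa [sub_zero, smul_eq_mul] at this
      rw [Finset.sum_range_succ]
      dsimp only
      rw [if_pos rfl, hfg z hz, pow_succ, mul_assoc, hds]
      have hsum : ∑ k ∈ range N, (if k = N then g 0 else a k) * z ^ k =
          ∑ k ∈ range N, a k * z ^ k :=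
        Finset.sum_congr rfl fun k hk ↦ by rw [if_neg (Finset.mem_range.mp hk).ne]
      rw [hsum]
      ring
  obtain ⟨a, g, hg, hfg⟩ := key N
  -- The Taylor series of `f` is then `Σ a_k X^k + X^N 𝓣[g]`, so `a_k = [qᵏ] 𝓣[f]` for `k < N`.
  have hfa : AnalyticAt ℂ f 0 := analyticAt_of_differentiableOn_ball hr hf
  have hga : AnalyticAt ℂ g 0 := analyticAt_of_differentiableOn_ball hr hg
  have hterm : ∀ k : ℕ, AnalyticAt ℂ (fun z : ℂ ↦ a k * z ^ k) 0 := fun k ↦ by fun_prop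
  have hfun : (fun z : ℂ ↦ ∑ k ∈ range N, a k * z ^ k) =
      ∑ k ∈ range N, fun z : ℂ ↦ a k * z ^ k := by
    funext z
    simp [Finset.sum_apply]
  have hpoly : AnalyticAt ℂ (fun z ↦ ∑ k ∈ range N, a k * z ^ k) 0 :=
    Finset.analyticAt_fun_sum _ fun k _ ↦ hterm k
  have hzN : AnalyticAt ℂ (fun z : ℂ ↦ z ^ N) 0 := by fun_prop
  have hmon : AnalyticAt ℂ (fun z : ℂ ↦ z ^ N * g z) 0 := hzN.mul hga
  have hT : 𝓣[f] = (∑ k ∈ range N, PowerSeries.C (a k) * PowerSeries.X ^ k) +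
      PowerSeries.X ^ N * 𝓣[g] := by
    have heq : f =ᶠ[𝓝 0] (fun z ↦ ∑ k ∈ range N, a k * z ^ k) + fun z ↦ z ^ N * g z := by
      filter_upwards [hball] with z hz
      simpa using hfg z hz
    rw [taylor_congr heq, taylor_add hpoly hmon]
    congr 1
    · rw [hfun, taylor_sum _ (fun k _ ↦ hterm k)]
      refine Finset.sum_congr rfl fun k _ ↦ ?_
      rw [taylor_const_mul, taylor_pow_id]
    · have h1 : 𝓣[fun z : ℂ ↦ z ^ N * g z] = 𝓣[(fun z : ℂ ↦ z ^ N) * g] := rfl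
      rw [h1, taylor_mul hzN hga, taylor_pow_id]
  have hcoeff : ∀ k ∈ range N, a k = coeff k 𝓣[f] := by
    intro k hk
    have hkN : k < N := Finset.mem_range.mp hk
    rw [hT, map_add, PowerSeries.coeff_X_pow_mul', if_neg (not_le.mpr hkN), add_zero,
      map_sum]
    simp only [PowerSeries.coeff_C_mul_X_pow]
    rw [Finset.sum_eq_single k (fun j _ hj ↦ if_neg (Ne.symm hj)) (fun h ↦ absurd hk h),
      if_pos rfl]
  refine ⟨g, hg, fun z hz ↦ ?_, ?_⟩
  · rw [hfg z hz]
    congr 1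
    exact Finset.sum_congr rfl fun k hk ↦ by rw [hcoeff k hk]
  · nth_rw 1 [hT]
    congr 1
    exact Finset.sum_congr rfl fun k hk ↦ by rw [hcoeff k hk]

/-- **Formal divisibility by `q^N` is analytic divisibility**: if the Taylor coefficients of a
holomorphic `f` on `|z| < r` vanish below `N`, then `f = z^N g` on the disc with `g` holomorphic
there, `𝓣[f] = X^N 𝓣[g]` and `g(0) = [q^N] 𝓣[f]`. [folklore] -/
theorem exists_eq_pow_mul_of_coeff_eq_zero {f : ℂ → ℂ} {r : ℝ} (hr : 0 < r)
    (hf : DifferentiableOn ℂ f (ball 0 r)) {N : ℕ} (h0 : ∀ k < N, coeff k 𝓣[f] = 0) :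
    ∃ g : ℂ → ℂ, DifferentiableOn ℂ g (ball 0 r) ∧ (∀ z ∈ ball 0 r, f z = z ^ N * g z) ∧
      𝓣[f] = PowerSeries.X ^ N * 𝓣[g] ∧ g 0 = coeff N 𝓣[f] := by
  obtain ⟨g, hg, hfg, hT⟩ := exists_taylor_remainder_on_ball hr hf N
  have hsum0 : ∀ z : ℂ, ∑ k ∈ range N, coeff k 𝓣[f] * z ^ k = 0 := fun z ↦
    Finset.sum_eq_zero fun k hk ↦ by rw [h0 k (Finset.mem_range.mp hk), zero_mul]
  have hsum1 : ∑ k ∈ range N, PowerSeries.C (coeff k 𝓣[f]) * PowerSeries.X ^ k = 0 :=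
    Finset.sum_eq_zero fun k hk ↦ by rw [h0 k (Finset.mem_range.mp hk), map_zero, zero_mul]
  have hT' : 𝓣[f] = PowerSeries.X ^ N * 𝓣[g] := by rw [hT, hsum1, zero_add]
  refine ⟨g, hg, fun z hz ↦ by rw [hfg z hz, hsum0, zero_add], hT', ?_⟩
  have := congrArg (coeff N) hT'
  rw [PowerSeries.coeff_X_pow_mul', if_pos le_rfl, Nat.sub_self, coeff_zero_eq_constantCoeff,
    constantCoeff_taylor] at this
  exact this.symm

/-- **Holomorphic division with prescribed Taylor series.** If `N, D` are holomorphic on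
`|z| < r`, `𝓣[D] ≠ 0` and `𝓣[N] = 𝓣[D] · E` formally, then near `0` we have `N = D · b` with
`b` holomorphic and `𝓣[b] = E`. [folklore] -/
theorem exists_eq_mul_of_taylor_eq_mul {N D : ℂ → ℂ} {r : ℝ} (hr : 0 < r)
    (hN : DifferentiableOn ℂ N (ball 0 r)) (hD : DifferentiableOn ℂ D (ball 0 r))
    (hD0 : 𝓣[D] ≠ 0) {E : PowerSeries ℂ} (hE : 𝓣[N] = 𝓣[D] * E) :
    ∃ ε > 0, ε ≤ r ∧ ∃ b : ℂ → ℂ, DifferentiableOn ℂ b (ball 0 ε) ∧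
      (∀ z ∈ ball 0 ε, D z ≠ 0 ∨ z = 0) ∧ (∀ z ∈ ball 0 ε, N z = D z * b z) ∧ 𝓣[b] = E := by
  -- `v = ord 𝓣[D]`
  set v : ℕ := (𝓣[D]).order.toNat with hv
  have hvord : (𝓣[D]).order = v :=
    (ENat.coe_toNat (lt_top_iff_ne_top.mp (order_finite_iff_ne_zero.mpr hD0))).symm
  have hDlt : ∀ i < v, coeff i 𝓣[D] = 0 := fun i hi ↦
    coeff_of_lt_order i (by rw [hvord]; exact_mod_cast hi)
  have hDv : coeff v 𝓣[D] ≠ 0 := by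
    have := coeff_order hD0
    rwa [hvord, ENat.toNat_coe] at this
  have hNlt : ∀ i < v, coeff i 𝓣[N] = 0 := fun i hi ↦ by
    rw [hE, PowerSeries.coeff_mul]
    refine Finset.sum_eq_zero fun ij hij ↦ ?_
    have h1 : ij.1 ≤ i := by
      have := Finset.mem_antidiagonal.mp hij
      omega
    rw [hDlt ij.1 (h1.trans_lt hi), zero_mul]
  obtain ⟨D₁, hD₁, hDD₁, hTD, hD₁0⟩ := exists_eq_pow_mul_of_coeff_eq_zero hr hD hDlt
  obtain ⟨N₁, hN₁, hNN₁, hTN, -⟩ := exists_eq_pow_mul_of_coeff_eq_zero hr hN hNlt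
  have hD₁ne : D₁ 0 ≠ 0 := by rwa [hD₁0]
  -- `D₁ ≠ 0` on a small disc
  have hcont : ContinuousAt D₁ 0 :=
    (hD₁.differentiableAt (ball_mem_nhds 0 hr)).continuousAt
  obtain ⟨ε₀, hε₀, hε₀ne⟩ : ∃ ε₀ > 0, ∀ z ∈ ball (0 : ℂ) ε₀, D₁ z ≠ 0 := by
    have hev : ∀ᶠ z in 𝓝 (0 : ℂ), D₁ z ≠ 0 := hcont.eventually_ne hD₁ne
    obtain ⟨ε₀, hε₀, h⟩ := Metric.eventually_nhds_iff.mp hev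
    exact ⟨ε₀, hε₀, fun z hz ↦ h hz⟩
  set ε : ℝ := min ε₀ r with hεdef
  have hε : 0 < ε := lt_min hε₀ hr
  have hεr : ε ≤ r := min_le_right _ _
  have hεball : ball (0 : ℂ) ε ⊆ ball 0 r := ball_subset_ball hεr
  have hεball' : ball (0 : ℂ) ε ⊆ ball 0 ε₀ := ball_subset_ball (min_le_left _ _)
  refine ⟨ε, hε, hεr, fun z ↦ N₁ z / D₁ z, ?_, ?_, ?_, ?_⟩
  · exact (hN₁.mono hεball).div (hD₁.mono hεball) fun z hz ↦ hε₀ne z (hεball' hz)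
  · intro z hz
    by_cases hz0 : z = 0
    · exact Or.inr hz0
    · left
      rw [hDD₁ z (hεball hz)]
      exact mul_ne_zero (pow_ne_zero _ hz0) (hε₀ne z (hεball' hz))
  · intro z hz
    rw [hNN₁ z (hεball hz), hDD₁ z (hεball hz)]
    field_simp [hε₀ne z (hεball' hz)]
  · -- `X^v 𝓣[D₁] 𝓣[b] = 𝓣[N] = X^v 𝓣[D₁] E`
    have hba : AnalyticAt ℂ (fun z ↦ N₁ z / D₁ z) 0 :=
      (analyticAt_of_differentiableOn_ball hr hN₁).div
        (analyticAt_of_differentiableOn_ball hr hD₁) hD₁ne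
    have hD₁a : AnalyticAt ℂ D₁ 0 := analyticAt_of_differentiableOn_ball hr hD₁
    have hprod : 𝓣[N₁] = 𝓣[D₁] * 𝓣[fun z ↦ N₁ z / D₁ z] := by
      have heq : N₁ =ᶠ[𝓝 0] D₁ * fun z ↦ N₁ z / D₁ z := by
        filter_upwards [ball_mem_nhds (0 : ℂ) hε] with z hz
        simp only [Pi.mul_apply]
        field_simp [hε₀ne z (hεball' hz)]
      rw [taylor_congr heq, taylor_mul hD₁a hba]
    have h1 : PowerSeries.X ^ v * 𝓣[D₁] * 𝓣[fun z ↦ N₁ z / D₁ z] =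
        PowerSeries.X ^ v * 𝓣[D₁] * E := by
      rw [mul_assoc, ← hprod, ← hTN, hE, hTD]
    have hne : PowerSeries.X ^ v * 𝓣[D₁] ≠ 0 := by rw [← hTD]; exact hD0
    exact mul_left_cancel₀ hne h1

/-! ### 4. A simple zero of a holomorphic function of two variables moves holomorphically -/

/-- **Holomorphic dependence of a simple zero on a parameter** (the one-variable holomorphic
implicit function theorem, from the Weierstrass set-up: near a simple zero the number of zeros of
the slices in a small disc is constantly one and their sum is holomorphic). Let `Φ` be
holomorphic on an open `Ω ⊆ ℂ × ℂ` containing `(t₀, w₀)` with `Φ(t₀, w₀) = 0` and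
`∂Φ/∂w (t₀, w₀) ≠ 0`. Then there are `ε, δ > 0` and `z` holomorphic on `|t - t₀| < ε` with
`z(t₀) = w₀`, `|z(t) - w₀| < δ`, `(t, z t) ∈ Ω`, `Φ(t, z t) = 0`, and `z t` is the ONLY zero of
`Φ(t, ·)` in `|w - w₀| < δ`. [cite: Chirka1989, §1.1, p. 3] [folklore] -/
theorem exists_holomorphic_simple_root {Φ : ℂ × ℂ → ℂ} {Ω : Set (ℂ × ℂ)} (hΩ : IsOpen Ω)
    (hΦ : DifferentiableOn ℂ Φ Ω) {t₀ w₀ : ℂ} (h₀ : (t₀, w₀) ∈ Ω) (hroot : Φ (t₀, w₀) = 0)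
    (hsimple : deriv (fun w ↦ Φ (t₀, w)) w₀ ≠ 0) :
    ∃ ε > 0, ∃ δ > 0, ∃ z : ℂ → ℂ, DifferentiableOn ℂ z (ball t₀ ε) ∧ z t₀ = w₀ ∧
      (∀ t ∈ ball t₀ ε, z t ∈ ball w₀ δ ∧ (t, z t) ∈ Ω ∧ Φ (t, z t) = 0) ∧
      ∀ t ∈ ball t₀ ε, ∀ w ∈ ball w₀ δ, Φ (t, w) = 0 → w = z t := by
  classical
  -- the slice at `t₀` is analytic at `w₀` and has a simple zero there
  set g : ℂ → ℂ := fun w ↦ Φ (t₀, w) with hg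
  obtain ⟨ρ, hρ, hρΩ⟩ := Metric.isOpen_iff.1 hΩ (t₀, w₀) h₀
  have hgd : DifferentiableOn ℂ g (ball w₀ ρ) := by
    refine hΦ.comp (by fun_prop) fun w hw ↦ hρΩ ?_
    rw [← ball_prod_same]
    exact mk_mem_prod (mem_ball_self hρ) hw
  have hga : AnalyticAt ℂ g w₀ := (hgd.analyticOnNhd isOpen_ball) w₀ (mem_ball_self hρ)
  have hne : ¬ (fun w ↦ Φ (t₀, w)) =ᶠ[𝓝 w₀] 0 := by
    intro h
    apply hsimple
    rw [h.deriv_eq]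
    simp
  have hord : analyticOrderNatAt (fun w ↦ Φ (t₀, w)) w₀ = 1 := by
    rw [analyticOrderNatAt, hga.analyticOrderAt_eq_one_of_zero_deriv_ne_zero hroot hsimple]
    rfl
  obtain ⟨ε, r, R, hε, hsub, hW, -, hroots⟩ := exists_weierstrassData hΩ hΦ h₀ hne
  rw [hord, Multiset.replicate_one] at hroots
  -- exactly one root in the small disc for every parameter
  have hcard : ∀ t ∈ ball t₀ ε, Multiset.card (sliceRoots Φ w₀ r t) = 1 := by
    intro t ht
    rw [hW.card_sliceRoots_eq (convex_ball t₀ ε).isPreconnected (mem_ball_self hε) ht, hroots,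
      Multiset.card_singleton]
  have hmem : ∀ t ∈ ball t₀ ε, ∀ w : ℂ,
      w ∈ sliceRoots Φ w₀ r t ↔ w ∈ ball w₀ r ∧ Φ (t, w) = 0 := fun t ht w ↦ by
    simp only [sliceRoots]
    exact mem_rootMultiset_iff (hW.differentiableOn_slice ht) hW.pos hW.lt (hW.ne_zero t ht)
  -- the root function: the sum of the (one) root
  set z : ℂ → ℂ := fun t ↦ ((sliceRoots Φ w₀ r t).map fun w ↦ (t, w).2).sum with hz
  have hzd : DifferentiableOn ℂ z (ball t₀ ε) :=
    hW.differentiableOn_rootSum (g := fun x ↦ x.2) differentiableOn_snd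
  have hzroot : ∀ t ∈ ball t₀ ε, sliceRoots Φ w₀ r t = {z t} := by
    intro t ht
    obtain ⟨a, ha⟩ := Multiset.card_eq_one.mp (hcard t ht)
    have : z t = a := by simp [hz, ha]
    rw [this, ha]
  refine ⟨ε, hε, r, hW.pos, z, hzd, ?_, fun t ht ↦ ?_, fun t ht w hw hΦw ↦ ?_⟩
  · have h1 : w₀ ∈ sliceRoots Φ w₀ r t₀ := by rw [hroots]; exact Multiset.mem_singleton_self _
    rw [hzroot t₀ (mem_ball_self hε), Multiset.mem_singleton] at h1
    exact h1.symm
  · have h1 : z t ∈ sliceRoots Φ w₀ r t := by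
      rw [hzroot t ht]; exact Multiset.mem_singleton_self _
    obtain ⟨hball, hzero⟩ := (hmem t ht (z t)).1 h1
    exact ⟨hball, hsub (mk_mem_prod ht (ball_subset_ball hW.lt.le hball)), hzero⟩
  · have h1 : w ∈ sliceRoots Φ w₀ r t := (hmem t ht w).2 ⟨hw, hΦw⟩
    rw [hzroot t ht, Multiset.mem_singleton] at h1
    exact h1

/-! ### 5. The binomial remainder and the main theorem -/

/-- `(u + h)ⁿ = uⁿ + n uⁿ⁻¹ h + h² · Σ_{2 ≤ k ≤ n} C(n,k) uⁿ⁻ᵏ hᵏ⁻²`. [folklore] -/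
theorem add_pow_eq_three_terms (n : ℕ) (u h : ℂ) :
    (u + h) ^ n = u ^ n + n * u ^ (n - 1) * h + h ^ 2 *
      ∑ k ∈ range (n + 1), (if 2 ≤ k then (n.choose k : ℂ) * u ^ (n - k) * h ^ (k - 2) else 0) := by
  rw [add_comm u h, add_pow, Finset.mul_sum]
  have key : ∀ k ∈ range (n + 1), h ^ k * u ^ (n - k) * (n.choose k : ℂ) =
      (if k = 0 then u ^ n else 0) + (if k = 1 then (n : ℂ) * u ^ (n - 1) * h else 0) +
        h ^ 2 * (if 2 ≤ k then (n.choose k : ℂ) * u ^ (n - k) * h ^ (k - 2) else 0) := by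
    intro k _
    rcases Nat.lt_trichotomy k 1 with hk | rfl | hk
    · obtain rfl : k = 0 := by omega
      simp
    · simp only [pow_one, Nat.choose_one_right, one_ne_zero, if_false, if_true, zero_add,
        Nat.not_ofNat_le_one]
      ring
    · rw [if_neg (by omega), if_neg (by omega), if_pos (by omega), zero_add, zero_add]
      obtain ⟨j, rfl⟩ : ∃ j, k = j + 2 := ⟨k - 2, by omega⟩
      rw [Nat.add_sub_cancel, pow_add]
      ring
  rw [Finset.sum_congr rfl key, Finset.sum_add_distrib, Finset.sum_add_distrib,
    Finset.sum_ite_eq', Finset.sum_ite_eq', if_pos (by simp)]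
  by_cases h1 : (1 : ℕ) ∈ range (n + 1)
  · rw [if_pos h1]
  · rw [if_neg h1]
    obtain rfl : n = 0 := by
      rw [Finset.mem_range] at h1
      omega
    simp

/-- The tail `Σ_{2 ≤ k ≤ n} C(n,k) F₁ⁿ⁻ᵏ F₂ᵏ⁻²` is differentiable for differentiable `F₁, F₂`.
[folklore] -/
theorem differentiable_binomTail {F₁ F₂ : ℂ × ℂ → ℂ} (h₁ : Differentiable ℂ F₁)
    (h₂ : Differentiable ℂ F₂) (n : ℕ) :
    Differentiable ℂ fun x ↦ ∑ k ∈ range (n + 1),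
      (if 2 ≤ k then (n.choose k : ℂ) * F₁ x ^ (n - k) * F₂ x ^ (k - 2) else 0) := by
  refine Differentiable.fun_sum fun k _ ↦ ?_
  split_ifs
  · exact ((differentiable_const _).mul (h₁.pow _)).mul (h₂.pow _)
  · exact differentiable_const _

/-- **A simple formal root of a polynomial with analytic coefficients is analytic** (convergence
of formal solutions in the non-degenerate case). Let `b₀, …, b_d` be holomorphic on `|q| < r`
and `𝒬 ∈ ℂ⟦q⟧[Y]` the polynomial of degree `≤ d` with coefficients their Taylor series
`𝓣[bₙ]`. If `ŷ ∈ ℂ⟦q⟧` satisfies `𝒬(ŷ) = 0` and `𝒬'(ŷ) ≠ 0`, then for every `K₀` there are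
`K ≥ K₀`, `0 < ε ≤ r` and `y` holomorphic on `|q| < ε` with `Σₙ bₙ(q) y(q)ⁿ = 0` there and
`[qⁿ] 𝓣[y] = [qⁿ] ŷ` for all `n < K`. [folklore] -/
theorem exists_holomorphic_root_of_formal_root {d : ℕ} {b : ℕ → ℂ → ℂ} {r : ℝ} (hr : 0 < r)
    (hb : ∀ n ∈ range (d + 1), DifferentiableOn ℂ (b n) (ball 0 r))
    (𝒬 : (PowerSeries ℂ)[X]) (hdeg : 𝒬.natDegree ≤ d)
    (hcoef : ∀ n ∈ range (d + 1), 𝒬.coeff n = 𝓣[b n]) {ŷ : PowerSeries ℂ}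
    (hroot : 𝒬.eval ŷ = 0) (hsimple : (Polynomial.derivative 𝒬).eval ŷ ≠ 0) (K₀ : ℕ) :
    ∃ K ≥ K₀, ∃ ε > 0, ε ≤ r ∧ ∃ y : ℂ → ℂ, DifferentiableOn ℂ y (ball 0 ε) ∧
      (∀ z ∈ ball 0 ε, ∑ n ∈ range (d + 1), b n z * y z ^ n = 0) ∧
      ∀ n < K, coeff n 𝓣[y] = coeff n ŷ := by
  classical
  have hball : ball (0 : ℂ) r ∈ 𝓝 (0 : ℂ) := ball_mem_nhds 0 hr
  -- ### the order `v` of `𝒬'(ŷ)`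
  set 𝒬' : (PowerSeries ℂ)[X] := Polynomial.derivative 𝒬 with h𝒬'
  set v : ℕ := (𝒬'.eval ŷ).order.toNat with hv
  have hvord : (𝒬'.eval ŷ).order = v :=
    (ENat.coe_toNat (lt_top_iff_ne_top.mp (order_finite_iff_ne_zero.mpr hsimple))).symm
  have hvlt : ∀ i < v, coeff i (𝒬'.eval ŷ) = 0 := fun i hi ↦
    coeff_of_lt_order i (by rw [hvord]; exact_mod_cast hi)
  have hvne : coeff v (𝒬'.eval ŷ) ≠ 0 := by
    have := coeff_order hsimple
    rwa [hvord, ENat.toNat_coe] at this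
  -- ### the truncation `p` of `ŷ` at order `M + v`, `M = K₀ + 1 + v`
  set M : ℕ := K₀ + 1 + v with hM
  set p : ℂ[X] := trunc (M + v) ŷ with hpdef
  have hp : ∀ n < M + v, p.coeff n = coeff n ŷ := fun n hn ↦ by
    rw [hpdef, coeff_trunc, if_pos hn]
  have hdvd : (PowerSeries.X : PowerSeries ℂ) ^ (M + v) ∣ (p : PowerSeries ℂ) - ŷ := by
    refine PowerSeries.X_pow_dvd_iff.mpr fun m hm ↦ ?_
    rw [map_sub, Polynomial.coeff_coe, hp m hm, sub_self]
  -- formal consequences of `ŷ ≡ p (mod X^{M+v})`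
  have hAdvd : (PowerSeries.X : PowerSeries ℂ) ^ (M + v) ∣ 𝒬.eval (p : PowerSeries ℂ) := by
    have h := Polynomial.sub_dvd_eval_sub (p : PowerSeries ℂ) ŷ 𝒬
    rw [hroot, sub_zero] at h
    exact hdvd.trans h
  have hBdvd : (PowerSeries.X : PowerSeries ℂ) ^ (M + v) ∣
      𝒬'.eval (p : PowerSeries ℂ) - 𝒬'.eval ŷ :=
    hdvd.trans (Polynomial.sub_dvd_eval_sub _ _ _)
  -- ### the analytic objects
  set pf : ℂ → ℂ := fun z ↦ p.eval z with hpf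
  have hpfd : Differentiable ℂ pf := Polynomial.differentiable p
  have hpfA : AnalyticAt ℂ pf 0 := hpfd.analyticAt 0
  have hpfn : ∀ n : ℕ, AnalyticAt ℂ (pf ^ n) 0 := fun n ↦ hpfA.pow n
  have hTpf : 𝓣[pf] = (p : PowerSeries ℂ) := taylor_polynomial p
  have hbA : ∀ n ∈ range (d + 1), AnalyticAt ℂ (b n) 0 := fun n hn ↦
    analyticAt_of_differentiableOn_ball hr (hb n hn)
  set A : ℂ → ℂ := fun z ↦ ∑ n ∈ range (d + 1), b n z * pf z ^ n with hA
  set B : ℂ → ℂ := fun z ↦ ∑ n ∈ range (d + 1), b n z * ((n : ℂ) * pf z ^ (n - 1)) with hB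
  have hAd : DifferentiableOn ℂ A (ball 0 r) :=
    DifferentiableOn.fun_sum fun n hn ↦ (hb n hn).mul ((hpfd.pow n).differentiableOn)
  have hBd : DifferentiableOn ℂ B (ball 0 r) :=
    DifferentiableOn.fun_sum fun n hn ↦
      (hb n hn).mul (((differentiable_const _).mul (hpfd.pow _)).differentiableOn)
  -- `𝒬 = Σ_{n ≤ d} C(𝓣[b n]) Yⁿ`
  have h𝒬sum : 𝒬 = ∑ n ∈ range (d + 1), Polynomial.C 𝓣[b n] * Polynomial.X ^ n := by
    conv_lhs => rw [𝒬.as_sum_range' (d + 1) (Nat.lt_succ_of_le hdeg)]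
    refine Finset.sum_congr rfl fun n hn ↦ ?_
    rw [hcoef n hn]
    exact Polynomial.C_mul_X_pow_eq_monomial.symm
  -- Taylor series of `A` and `B`
  have hTA : 𝓣[A] = 𝒬.eval (p : PowerSeries ℂ) := by
    have hAfun : A = ∑ n ∈ range (d + 1), (b n * pf ^ n) := by
      funext z
      simp [hA, Finset.sum_apply]
    rw [hAfun, taylor_sum _ (fun n hn ↦ (hbA n hn).mul (hpfn n))]
    conv_rhs => rw [h𝒬sum, Polynomial.eval_finsetSum]
    refine Finset.sum_congr rfl fun n hn ↦ ?_
    rw [taylor_mul (hbA n hn) (hpfn n), taylor_pow hpfA, hTpf, Polynomial.eval_mul,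
      Polynomial.eval_C, Polynomial.eval_pow, Polynomial.eval_X]
  have hTB : 𝓣[B] = 𝒬'.eval (p : PowerSeries ℂ) := by
    have hBfun : B = ∑ n ∈ range (d + 1), (b n * fun z ↦ (n : ℂ) * (pf ^ (n - 1)) z) := by
      funext z
      simp [hB, Finset.sum_apply]
    have han : ∀ n : ℕ, AnalyticAt ℂ (fun z ↦ (n : ℂ) * (pf ^ (n - 1)) z) 0 := fun n ↦
      analyticAt_const.mul (hpfn (n - 1))
    rw [hBfun, taylor_sum _ (fun n hn ↦ (hbA n hn).mul (han n))]
    conv_rhs => rw [h𝒬', h𝒬sum, Polynomial.derivative_sum, Polynomial.eval_finsetSum]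
    refine Finset.sum_congr rfl fun n hn ↦ ?_
    rw [taylor_mul (hbA n hn) (han n), taylor_const_mul, taylor_pow hpfA, hTpf,
      Polynomial.derivative_C_mul_X_pow, Polynomial.eval_mul, Polynomial.eval_C,
      Polynomial.eval_pow, Polynomial.eval_X, map_natCast]
    ring
  -- ### analytic divisibility: `A = z^{M+v} At`, `B = z^v Bt`, `Bt 0 ≠ 0`
  have hAcoeff : ∀ k < M + v, coeff k 𝓣[A] = 0 := fun k hk ↦ by
    rw [hTA]
    exact (PowerSeries.X_pow_dvd_iff.mp hAdvd) k hk
  have hvM : v < M + v := by omega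
  have hBcoeff : ∀ k < M + v, coeff k 𝓣[B] = coeff k (𝒬'.eval ŷ) := fun k hk ↦ by
    have := (PowerSeries.X_pow_dvd_iff.mp hBdvd) k hk
    rw [map_sub, sub_eq_zero] at this
    rw [hTB, this]
  obtain ⟨At, hAtd, hAAt, -, -⟩ := exists_eq_pow_mul_of_coeff_eq_zero hr hAd hAcoeff
  obtain ⟨Bt, hBtd, hBBt, -, hBt0⟩ := exists_eq_pow_mul_of_coeff_eq_zero hr hBd
    (N := v) fun k hk ↦ by rw [hBcoeff k (hk.trans hvM), hvlt k hk]
  have hBtne : Bt 0 ≠ 0 := by rwa [hBt0, hBcoeff v hvM]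
  -- ### the desingularised equation `Φ(z, W) = 0`
  set S : ℂ × ℂ → ℂ := fun x ↦ ∑ n ∈ range (d + 1), b n x.1 *
    ∑ k ∈ range (n + 1),
      (if 2 ≤ k then (n.choose k : ℂ) * pf x.1 ^ (n - k) * x.2 ^ (k - 2) else 0) with hS
  set Φ : ℂ × ℂ → ℂ := fun x ↦
    At x.1 + x.2 * Bt x.1 + x.1 ^ (K₀ + 1) * x.2 ^ 2 * S (x.1, x.1 ^ M * x.2) with hΦ
  -- the key identity
  have hkey : ∀ z ∈ ball (0 : ℂ) r, ∀ W : ℂ,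
      ∑ n ∈ range (d + 1), b n z * (pf z + z ^ M * W) ^ n = z ^ (M + v) * Φ (z, W) := by
    intro z hz W
    have hsplit : ∀ h : ℂ, ∑ n ∈ range (d + 1), b n z * (pf z + h) ^ n =
        A z + h * B z + h ^ 2 * S (z, h) := by
      intro h
      have hAz : A z = ∑ n ∈ range (d + 1), b n z * pf z ^ n := rfl
      have hBz : B z = ∑ n ∈ range (d + 1), b n z * ((n : ℂ) * pf z ^ (n - 1)) := rfl
      have hSz : S (z, h) = ∑ n ∈ range (d + 1), b n z * ∑ k ∈ range (n + 1),
          (if 2 ≤ k then (n.choose k : ℂ) * pf z ^ (n - k) * h ^ (k - 2) else 0) := rfl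
      rw [hAz, hBz, hSz, Finset.mul_sum, Finset.mul_sum, ← Finset.sum_add_distrib,
        ← Finset.sum_add_distrib]
      refine Finset.sum_congr rfl fun n _ ↦ ?_
      rw [add_pow_eq_three_terms]
      ring
    rw [hsplit, hAAt z hz, hBBt z hz, hΦ, hM]
    ring
  -- `Φ` is holomorphic on `ball 0 r × ℂ`
  set Ω : Set (ℂ × ℂ) := ball 0 r ×ˢ (Set.univ : Set ℂ) with hΩ
  have hΩo : IsOpen Ω := isOpen_ball.prod isOpen_univ
  have hfst : ∀ x ∈ Ω, x.1 ∈ ball (0 : ℂ) r := fun x hx ↦ (mem_prod.mp hx).1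
  have hSd : Differentiable ℂ fun x : ℂ × ℂ ↦ (x.1, x.1 ^ M * x.2) := by fun_prop
  have hΦd : DifferentiableOn ℂ Φ Ω := by
    have h1 : DifferentiableOn ℂ (fun x : ℂ × ℂ ↦ At x.1) Ω :=
      hAtd.comp differentiableOn_fst hfst
    have h2 : DifferentiableOn ℂ (fun x : ℂ × ℂ ↦ Bt x.1) Ω :=
      hBtd.comp differentiableOn_fst hfst
    have h3 : DifferentiableOn ℂ (fun x : ℂ × ℂ ↦ S (x.1, x.1 ^ M * x.2)) Ω := by
      have hS' : DifferentiableOn ℂ S Ω := by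
        refine DifferentiableOn.fun_sum fun n hn ↦ ?_
        refine ((hb n hn).comp differentiableOn_fst hfst).mul ?_
        exact (differentiable_binomTail (hpfd.comp differentiable_fst) differentiable_snd
          n).differentiableOn
      refine hS'.comp hSd.differentiableOn fun x hx ↦ ?_
      exact mk_mem_prod (hfst x hx) (Set.mem_univ _)
    simp only [hΦ]
    exact (h1.add (differentiableOn_snd.mul h2)).add
      (((differentiableOn_fst.pow _).mul (differentiableOn_snd.pow _)).mul h3)
  -- the base point `(0, W₀)`
  set W₀ : ℂ := -At 0 / Bt 0 with hW₀
  have hK1 : K₀ + 1 ≠ 0 := Nat.succ_ne_zero _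
  have hslice : (fun W ↦ Φ (0, W)) = fun W ↦ At 0 + W * Bt 0 := by
    funext W
    simp only [hΦ, zero_pow hK1, zero_mul, add_zero]
  have hΦ0 : Φ (0, W₀) = 0 := by
    have := congrFun hslice W₀
    rw [this, hW₀]
    field_simp
    ring
  have hderiv : deriv (fun W ↦ Φ (0, W)) W₀ ≠ 0 := by
    rw [hslice]
    have hd : HasDerivAt (fun W ↦ At 0 + W * Bt 0) (1 * Bt 0) W₀ :=
      ((hasDerivAt_id W₀).mul_const (Bt 0)).const_add (At 0)
    rw [hd.deriv, one_mul]
    exact hBtne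
  have h0Ω : ((0 : ℂ), W₀) ∈ Ω := mk_mem_prod (mem_ball_self hr) (Set.mem_univ _)
  obtain ⟨ε, hε, δ, -, w, hwd, -, hw, -⟩ :=
    exists_holomorphic_simple_root hΩo hΦd h0Ω hΦ0 hderiv
  -- ### the root `y = p + z^M w`
  set ε' : ℝ := min ε r with hε'
  have hε'pos : 0 < ε' := lt_min hε hr
  have hε'ε : ball (0 : ℂ) ε' ⊆ ball 0 ε := ball_subset_ball (min_le_left _ _)
  have hε'r : ball (0 : ℂ) ε' ⊆ ball 0 r := ball_subset_ball (min_le_right _ _)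
  set y : ℂ → ℂ := fun z ↦ pf z + z ^ M * w z with hy
  have hwA : AnalyticAt ℂ w 0 := analyticAt_of_differentiableOn_ball hε hwd
  have hzM : AnalyticAt ℂ (fun z : ℂ ↦ z ^ M) 0 := by fun_prop
  refine ⟨M, by omega, ε', hε'pos, min_le_right _ _, y, ?_, ?_, ?_⟩
  · exact (hpfd.differentiableOn).add ((differentiableOn_id.pow _).mul (hwd.mono hε'ε))
  · intro z hz
    rw [hy]
    dsimp only
    rw [hkey z (hε'r hz) (w z), (hw z (hε'ε hz)).2.2, mul_zero]
  · intro n hn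
    have hT : 𝓣[y] = (p : PowerSeries ℂ) + PowerSeries.X ^ M * 𝓣[w] := by
      have e1 : y = pf + (fun z : ℂ ↦ z ^ M) * w := by
        funext z
        simp [hy]
      rw [e1, taylor_add hpfA (hzM.mul hwA), taylor_mul hzM hwA, taylor_pow_id, hTpf]
    rw [hT, map_add, PowerSeries.coeff_X_pow_mul', if_neg (by omega), add_zero,
      Polynomial.coeff_coe, hp n (by omega)]

/-! ### 6. Simple roots from a full set of distinct roots (algebra) -/

/-- If a nonzero polynomial of degree `≤ #ι` over a domain has the `#ι` distinct roots `y i`,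
then its root multiset is `{y i}` and every `y i` is a SIMPLE root: `p'(y i) ≠ 0`. [folklore] -/
theorem roots_eq_and_derivative_eval_ne_zero {R : Type*} [CommRing R] [IsDomain R] {p : R[X]}
    (hp : p ≠ 0) {ι : Type*} [Fintype ι] {y : ι → R} (hy : Function.Injective y)
    (hcard : p.natDegree ≤ Fintype.card ι) (hroots : ∀ i, p.eval (y i) = 0) :
    p.roots = (Finset.univ.map ⟨y, hy⟩).val ∧
      ∀ i, (Polynomial.derivative p).eval (y i) ≠ 0 := by
  classical
  set S : Finset R := Finset.univ.map ⟨y, hy⟩ with hS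
  have hScard : S.card = Fintype.card ι := by rw [hS, Finset.card_map, Finset.card_univ]
  have hsub : S.val ≤ p.roots := by
    rw [Finset.val_le_iff_val_subset]
    intro a ha
    rw [Finset.mem_val, hS, Finset.mem_map] at ha
    obtain ⟨i, -, rfl⟩ := ha
    exact (Polynomial.mem_roots hp).2 (hroots i)
  have hle : Multiset.card p.roots ≤ Multiset.card S.val := by
    rw [Finset.card_val, hScard]
    exact (Polynomial.card_roots' p).trans hcard
  have heq : p.roots = S.val := (Multiset.eq_of_le_of_card_le hsub hle).symm
  refine ⟨heq, fun i ↦ ?_⟩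
  have hmem : y i ∈ S := by rw [hS, Finset.mem_map]; exact ⟨i, Finset.mem_univ _, rfl⟩
  have hmult : p.rootMultiplicity (y i) = 1 := by
    rw [← Polynomial.count_roots, heq, Multiset.count_eq_one_of_mem S.nodup (by rw [Finset.mem_val]; exact hmem)]
  intro hder
  have h1 : 1 < p.rootMultiplicity (y i) :=
    (Polynomial.one_lt_rootMultiplicity_iff_isRoot hp).2 ⟨hroots i, hder⟩
  omega

end FormalRoot

end Literature.Analysis.Complex
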